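import Summits.BirchSwinnertonDyer.BirchSwinnertonDyer.Theorems.KolyvaginRankRigidityAtTwoChebotarevOneClassAtTwoAlgebra
import Summits.BirchSwinnertonDyer.BirchSwinnertonDyer.Theorems.Rank1ResidualJetKolyvaginFrobeniusTorsion
import Literature.NumberTheory.EllipticCurves.HeegnerPointsKolyvaginEulerSystem
import Literature.NumberTheory.GaloisRepresentations.IntegralGaloisActionProofs
import HarnessLib

/-!
# Crux V2♭θ `KolyvaginCorankLowerBoundAtTwoTheta` (stmt-BirchSwinnertonDyer-27220), line
# `kolyvagin_depth_split`, inside of S1, piece P7a — BRICK B AT `2`: the `ℚ`-Frobenius at a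
# Kolyvagin prime with Gross's Frobenius condition acts on `E[2^M](ℚ̄)` as a conjugate of complex
# conjugation; its `±`-eigen-subgroups have `≤ 2^{M+1}` elements and contain an element of order `2^M`
# (helper, PROVED; width seat `bsd-line-krr2-p2` g6)

Road-K JET's brick B (`natCard_ker_frob_sub_smul_id_eq_pow`, `p` odd) reads the balanced
eigenspaces of `Frob_ℓ` on `E[p^k]` off Zhang's congruences `p^k ∣ ℓ + 1`, `p^k ∣ a_ℓ`.  At `p = 2`
the congruences do NOT suffice (`F = [[3,2],[2,1]] (mod 4)` has `tr F = 4`, `det F = -1`, `F² = 1`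
and `ker(F ∓ 1) = E[2]`): one needs Gross's condition (3.2) `Frob(ℓ) = Frob(∞)` in
`Gal(K(E[2^{M'}])/ℚ)` (tree: `FrobEqFrobInfty W K (2^{M'}) ℓ`, which the width seat's Čebotarev
supply at `2` produces).  This file proves, for a complex conjugation `c₀ ∈ Γ_ℚ` and `s = ±1`:
* `natCard_ker_conj_sub_smul_le` — `#ker(c₀ − s | E[2^M](ℚ̄)) ≤ 2^{M+1}` (from the seat's Weil-pairing
  bit `exists_pow_smul_add_sign_conj_ne_zero`: `(c₀ − s) E[2^M]` has an element of order `≥ 2^{M-1}`);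
* `exists_conj_eigen_pow_smul_ne_zero` — an `s`-eigenvector of `c₀` in `E[2^M](ℚ̄)` of order `2^M`
  (symmetrise at level `2^{2M}` and multiply down);
* `exists_conj_of_frobEqFrobInfty` — under `FrobEqFrobInfty W K (2^{M'}) ℓ`, `M ≤ M'`, ANY arithmetic
  Frobenius `Fr` at the place `(ℓ)` (good, `ℓ` odd) acts on `E[2^M](ℚ̄)` as `g c₀ g⁻¹` (transitivity
  of `Γ_ℚ` on the primes above `ℓ`, `IsArithFrobAt.conj`, `IsArithFrobAt.mul_inv_mem_inertia`, and
  Silverman VII.4.1 `smul_geomTorsion_eq_of_mem_inertia`);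
* `natCard_ker_frob_sub_smul_le_of_frobEqFrobInfty`, `exists_frob_eigen_pow_smul_ne_zero` — the two
  facts transported to `Fr`.
HONEST FRAMING: helper lemmas (`--supports` 27220); S1 / V2♭θ are NOT proved; BSD is not proved.

References: [GrossLMS1991] §3 (3.2)–(3.4); [Jetchev2008] §3.2 (2); [SilvermanAEC2009] Prop.
VII.4.1 (a), III.8.1; [NeukirchANT1999] Ch. I §9 Prop. (9.1).
-/

set_option autoImplicit false
-- the Theorems namespace of this sub repeats the summit name by design (D-0017 nested layout)
set_option linter.dupNamespace false

noncomputable section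

open scoped Classical NumberField

namespace Summit.BirchSwinnertonDyer.BirchSwinnertonDyer.Theorems.KolyvaginLowerBoundAtTwo

open WeierstrassCurve Field Function IsDedekindDomain NumberField Rat.HeightOneSpectrum
open Literature.NumberTheory.GaloisRepresentations Literature.NumberTheory.EllipticCurves

variable (W : WeierstrassCurve ℚ) [W.IsElliptic]

/-! ### Complex conjugation on `E[2^M](ℚ̄)` -/

/-- **`#ker(c₀ − s | E[2^M](ℚ̄)) ≤ 2^{M+1}`** for a complex conjugation `c₀` and `s = ±1`, `M ≥ 1`:
`(c₀ − s) E[2^M]` contains an element of order `≥ 2^{M-1}` (`exists_pow_smul_add_sign_conj_ne_zero`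
with `ε = -s`) and `#E[2^M] = 2^{2M}`. (At `2` the eigenspaces are `ℤ/2^M ⊕ ℤ/2` or `ℤ/2^M`, not
`ℤ/2^M` as for odd `p`.) [cite: GrossLMS1991, §3 (3.4)] [cite: SilvermanAEC2009, Prop. III.8.1] -/
theorem natCard_ker_conj_sub_smul_le {c₀ : absoluteGaloisGroup ℚ}
    (hc₀ : IsComplexConjugation (Rat.castHom ℝ) c₀) {M : ℕ} (hM : 1 ≤ M) {s : ℤ}
    (hs : s = 1 ∨ s = -1) :
    Nat.card (DistribSMul.toAddMonoidHom (geomTorsion W ((2 ^ M : ℕ) : ℤ)) c₀ -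
        s • AddMonoidHom.id _).ker ≤ 2 ^ (M + 1) := by
  set T := geomTorsion W ((2 ^ M : ℕ) : ℤ) with hT
  set f : T →+ T := DistribSMul.toAddMonoidHom T c₀ - s • AddMonoidHom.id _ with hf
  have hfapply : ∀ x : T, f x = c₀ • x - s • x := fun _ => rfl
  have hn0 : ((2 ^ M : ℕ) : ℤ) ≠ 0 := by positivity
  haveI : Finite T := finite_torsionPoints_holds W (AlgebraicClosure ℚ) hn0
  have hcard : Nat.card T = 2 ^ (2 * M) := by
    rw [hT, mul_comm, pow_mul]
    exact card_torsionPoints_eq_sq_holds W (AlgebraicClosure ℚ) (n := 2 ^ M)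
      (by exact_mod_cast pow_ne_zero M two_ne_zero)
  have hsplit : Nat.card T = Nat.card f.ker * Nat.card f.range := by
    rw [← Nat.card_congr (QuotientAddGroup.quotientKerEquivRange f).toEquiv, mul_comm]
    exact f.ker.card_eq_card_quotient_mul_card_addSubgroup
  rcases Nat.lt_or_ge M 2 with hM1 | hM2
  · have hM1' : M = 1 := by omega
    subst hM1'
    calc Nat.card f.ker ≤ Nat.card T := Nat.card_le_card_of_injective _ Subtype.val_injective
      _ = 2 ^ (1 + 1) := by rw [hcard]
  · have hε : (-s) = 1 ∨ (-s) = -1 := by rcases hs with rfl | rfl <;> simp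
    obtain ⟨x, hx⟩ := exists_pow_smul_add_sign_conj_ne_zero W hc₀ hM2 hε
    have hfx : x + (-s) • c₀ • x = (-s) • f x := by
      rw [hfapply, smul_sub, smul_smul, show -s * s = -1 by rcases hs with rfl | rfl <;> norm_num,
        neg_one_zsmul, sub_neg_eq_add, add_comm]
    have hne : (2 ^ (M - 2)) • f x ≠ 0 := by
      intro h0
      apply hx
      rw [hfx, smul_comm, h0, smul_zero]
    have hexp : (2 ^ M) • f x = 0 := Subtype.ext (by
      rw [AddSubgroup.coe_nsmul, AddSubgroup.coe_zero, ← natCast_zsmul, Nat.cast_pow, Nat.cast_ofNat]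
      have := (mem_geomTorsion_iff W _ _).mp (f x).2
      exact_mod_cast this)
    -- the order of `f x` is `2^r` with `r ≥ M - 1`
    have hdvd : 2 ^ (M - 2 + 1) ∣ addOrderOf (f x) := by
      have h1 : addOrderOf (f x) ∣ 2 ^ M := addOrderOf_dvd_of_nsmul_eq_zero hexp
      obtain ⟨r, -, hre⟩ := (Nat.dvd_prime_pow Nat.prime_two).mp h1
      rw [hre]
      apply Nat.pow_dvd_pow
      by_contra hlt
      push Not at hlt
      apply hne
      have : addOrderOf (f x) ∣ 2 ^ (M - 2) := by rw [hre]; exact Nat.pow_dvd_pow 2 (by omega)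
      exact addOrderOf_dvd_iff_nsmul_eq_zero.mp this
    have hrange : 2 ^ (M - 1) ∣ Nat.card f.range := by
      rw [show M - 1 = M - 2 + 1 by omega]
      refine hdvd.trans ?_
      have hmem : f x ∈ f.range := ⟨x, rfl⟩
      have := addOrderOf_dvd_natCard (⟨f x, hmem⟩ : f.range)
      rwa [← AddSubgroup.addOrderOf_coe] at this
    obtain ⟨q, hq⟩ := hrange
    have hqpos : 0 < q := by
      rcases Nat.eq_zero_or_pos q with rfl | h
      · exfalso
        rw [mul_zero] at hq
        exact (Nat.card_pos (α := f.range)).ne' hq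
      · exact h
    have e : Nat.card f.ker * q * 2 ^ (M - 1) = 2 ^ (M + 1) * 2 ^ (M - 1) := by
      rw [← pow_add, show M + 1 + (M - 1) = 2 * M by omega, ← hcard, hsplit, hq]; ring
    have e' : Nat.card f.ker * q = 2 ^ (M + 1) := Nat.eq_of_mul_eq_mul_right (by positivity) e
    calc Nat.card f.ker = Nat.card f.ker * 1 := (mul_one _).symm
      _ ≤ Nat.card f.ker * q := Nat.mul_le_mul_left _ hqpos
      _ = 2 ^ (M + 1) := e'

/-- **An `s`-eigenvector of complex conjugation of order `2^M` in `E[2^M](ℚ̄)`** (`s = ±1`, `M ≥ 1`):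
symmetrise a suitable point of `E[2^{2M}]` (`y = x + s c₀ x` has order `≥ 2^{2M-1}` by
`exists_pow_smul_add_sign_conj_ne_zero`) and multiply it down into `E[2^M]`.
[cite: GrossLMS1991, §3 (3.4)] [cite: SilvermanAEC2009, Prop. III.8.1] -/
theorem exists_conj_eigen_pow_smul_ne_zero {c₀ : absoluteGaloisGroup ℚ}
    (hc₀ : IsComplexConjugation (Rat.castHom ℝ) c₀) {M : ℕ} (hM : 1 ≤ M) {s : ℤ}
    (hs : s = 1 ∨ s = -1) :
    ∃ P : geomTorsion W ((2 ^ M : ℕ) : ℤ), c₀ • P = s • P ∧ (2 ^ (M - 1)) • P ≠ 0 := by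
  have h2M : 2 ≤ 2 * M := by omega
  obtain ⟨x, hx⟩ := exists_pow_smul_add_sign_conj_ne_zero W hc₀ h2M hs
  have hs2 : s * s = 1 := by rcases hs with rfl | rfl <;> norm_num
  have hcc : c₀ * c₀ = 1 := by rw [← pow_two]; exact hc₀.sq_eq_one
  set y := x + s • c₀ • x with hy
  -- `y` is an `s`-eigenvector
  have hy_eig : c₀ • y = s • y := by
    rw [hy, smul_add, smul_comm c₀ s, smul_smul, hcc, one_smul, smul_add, smul_smul, hs2, one_smul,
      add_comm]
  have hyP : c₀ • (y : W.geomPoints) = s • (y : W.geomPoints) := by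
    have := congrArg Subtype.val hy_eig
    rwa [AddSubgroup.torsionBy.coe_smul, AddSubgroup.coe_zsmul] at this
  have hy0 : ((2 ^ (2 * M) : ℕ) : ℤ) • (y : W.geomPoints) = 0 := (mem_geomTorsion_iff W _ _).mp y.2
  have hx' : (2 ^ (2 * M - 2)) • (y : W.geomPoints) ≠ 0 := by
    intro h0
    apply hx
    exact Subtype.ext (by rw [AddSubgroup.coe_nsmul, h0, AddSubgroup.coe_zero])
  -- the Galois action commutes with multiples
  have hsmul_nsmul : ∀ (g : absoluteGaloisGroup ℚ) (n : ℕ) (Q : W.geomPoints),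
      g • (n • Q) = n • (g • Q) := fun g n Q => smul_comm g n Q
  by_cases hcase : (2 ^ (2 * M - 1)) • (y : W.geomPoints) = 0
  · -- `P = 2^{M-1} y`
    have hmem : (2 ^ (M - 1)) • (y : W.geomPoints) ∈ geomTorsion W ((2 ^ M : ℕ) : ℤ) := by
      rw [mem_geomTorsion_iff, natCast_zsmul, ← mul_nsmul', ← pow_add,
        show M + (M - 1) = 2 * M - 1 by omega, hcase]
    refine ⟨⟨_, hmem⟩, Subtype.ext ?_, fun h0 => hx' ?_⟩
    · rw [AddSubgroup.torsionBy.coe_smul, AddSubgroup.coe_zsmul]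
      change c₀ • ((2 ^ (M - 1)) • (y : W.geomPoints)) = s • ((2 ^ (M - 1)) • (y : W.geomPoints))
      rw [hsmul_nsmul, hyP, smul_comm]
    · have h1 := congrArg Subtype.val h0
      rw [AddSubgroup.coe_nsmul, AddSubgroup.coe_zero] at h1
      change (2 ^ (M - 1)) • ((2 ^ (M - 1)) • (y : W.geomPoints)) = 0 at h1
      rwa [← mul_nsmul', ← pow_add, show M - 1 + (M - 1) = 2 * M - 2 by omega] at h1
  · -- `P = 2^M y`
    have hmem : (2 ^ M) • (y : W.geomPoints) ∈ geomTorsion W ((2 ^ M : ℕ) : ℤ) := by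
      rw [mem_geomTorsion_iff, natCast_zsmul, ← mul_nsmul', ← pow_add, show M + M = 2 * M by omega]
      exact_mod_cast hy0
    refine ⟨⟨_, hmem⟩, Subtype.ext ?_, fun h0 => hcase ?_⟩
    · rw [AddSubgroup.torsionBy.coe_smul, AddSubgroup.coe_zsmul]
      change c₀ • ((2 ^ M) • (y : W.geomPoints)) = s • ((2 ^ M) • (y : W.geomPoints))
      rw [hsmul_nsmul, hyP, smul_comm]
    · have h1 := congrArg Subtype.val h0
      rw [AddSubgroup.coe_nsmul, AddSubgroup.coe_zero] at h1
      change (2 ^ (M - 1)) • ((2 ^ M) • (y : W.geomPoints)) = 0 at h1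
      rwa [← mul_nsmul', ← pow_add, show M - 1 + M = 2 * M - 1 by omega] at h1

/-! ### The `ℚ`-Frobenius at a Kolyvagin prime with Gross's condition (3.2) -/

/-- **Under `FrobEqFrobInfty W K (2^{M'}) ℓ` every arithmetic Frobenius at `(ℓ)` acts on
`E[2^M](ℚ̄)` (`M ≤ M'`) as a conjugate `g c₀ g⁻¹` of a complex conjugation.**  Gross's condition gives
an arithmetic Frobenius `h` at some prime `𝔓₁ ∣ ℓ` of `\bar ℤ` acting as `c₀` on `E[2^{M'}] ⊇ E[2^M]`;
any other prime above `ℓ` is `g 𝔓₁` (`exists_smul_eq_of_mem_primesAbove_holds`), `g h g⁻¹` is a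
Frobenius there (`IsArithFrobAt.conj`), and two Frobenius elements at the same prime differ by
inertia (`IsArithFrobAt.mul_inv_mem_inertia`), which fixes `E[2^M]` at the good odd prime `ℓ`
(Silverman VII.4.1). [cite: GrossLMS1991, §3 (3.2)] [cite: SilvermanAEC2009, Prop. VII.4.1 (a)]
[cite: NeukirchANT1999, Ch. I §9 Prop. (9.1)] -/
theorem exists_conj_of_frobEqFrobInfty {K : Type} [Field K] [NumberField K] {ℓ M M' : ℕ}
    (hℓ : ℓ.Prime) (hℓ2 : ℓ ≠ 2) (hF : FrobEqFrobInfty W K (2 ^ M') ℓ) (hMM' : M ≤ M')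
    {v : HeightOneSpectrum (𝓞 ℚ)} (hℓv : (ℓ : 𝓞 ℚ) ∈ v.asIdeal) (hgood : W.HasGoodReductionAt v)
    {Fr : absoluteGaloisGroup ℚ} (hFr : IsArithFrobAtPlace ℚ v Fr) :
    ∃ g c₀ : absoluteGaloisGroup ℚ, IsComplexConjugation (Rat.castHom ℝ) c₀ ∧
      ∀ P : geomTorsion W ((2 ^ M : ℕ) : ℤ), Fr • P = g • c₀ • g⁻¹ • P := by
  obtain ⟨v₁, 𝔓₁, h, c₀, hℓv₁, h𝔓₁, hh, hc₀, hP, -⟩ := hF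
  -- `v₁ = v`: both contain `ℓ`
  have hv : v₁ = v := by
    apply primesEquiv.injective
    apply Subtype.ext
    rw [primesEquiv_eq_of_natCast_mem hℓ hℓv₁, primesEquiv_eq_of_natCast_mem hℓ hℓv]
  subst hv
  obtain ⟨𝔓, h𝔓, hFr𝔓⟩ := hFr
  obtain ⟨g, hg⟩ := HeightOneSpectrum.exists_smul_eq_of_mem_primesAbove_holds h𝔓₁ h𝔓
  have hh' : IsArithFrobAt (𝓞 ℚ) (g * h * g⁻¹) 𝔓 := by rw [← hg]; exact hh.conj g
  have hin : Fr * (g * h * g⁻¹)⁻¹ ∈ 𝔓.inertia (absoluteGaloisGroup ℚ) :=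
    hFr𝔓.mul_inv_mem_inertia hh'
  -- `2^M ∉ v` since `ℓ` is odd
  have h2v : ((((2 ^ M : ℕ) : ℤ)) : 𝓞 ℚ) ∉ v₁.asIdeal := by
    intro hmem
    have hmem' : ((2 : ℕ) : 𝓞 ℚ) ^ M ∈ v₁.asIdeal := by
      have : ((((2 ^ M : ℕ) : ℤ)) : 𝓞 ℚ) = ((2 : ℕ) : 𝓞 ℚ) ^ M := by push_cast; ring
      rwa [this] at hmem
    have h2 : ((2 : ℕ) : 𝓞 ℚ) ∈ v₁.asIdeal := v₁.isPrime.mem_of_pow_mem M hmem'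
    have e1 := primesEquiv_eq_of_natCast_mem Nat.prime_two h2
    have e2 := primesEquiv_eq_of_natCast_mem hℓ hℓv₁
    exact hℓ2 (e2.symm.trans e1)
  refine ⟨g, c₀, hc₀, fun P => ?_⟩
  have htriv : (Fr * (g * h * g⁻¹)⁻¹) • ((g * h * g⁻¹) • P) = (g * h * g⁻¹) • P :=
    W.smul_geomTorsion_eq_of_mem_inertia hgood h2v h𝔓 hin _
  rw [smul_smul, inv_mul_cancel_right] at htriv
  rw [htriv, mul_smul, mul_smul]
  congr 1
  -- `h = c₀` on `E[2^M] ⊆ E[2^{M'}]`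
  set Q : geomTorsion W ((2 ^ M : ℕ) : ℤ) := g⁻¹ • P with hQ
  have hQ' : (Q : W.geomPoints) ∈ geomTorsion W ((2 ^ M' : ℕ) : ℤ) := by
    rw [mem_geomTorsion_iff]
    have h0 := (mem_geomTorsion_iff W _ _).mp Q.2
    rw [show ((2 ^ M' : ℕ) : ℤ) = ((2 ^ (M' - M) : ℕ) : ℤ) * ((2 ^ M : ℕ) : ℤ) by
      push_cast; rw [← pow_add]; congr 1; omega, mul_smul, h0, smul_zero]
  have e : h • (Q : W.geomPoints) = c₀ • (Q : W.geomPoints) := by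
    have := congrArg Subtype.val (hP ⟨Q, hQ'⟩)
    simp only [AddSubgroup.torsionBy.coe_smul] at this
    exact this
  exact Subtype.ext (by rw [AddSubgroup.torsionBy.coe_smul, AddSubgroup.torsionBy.coe_smul]; exact e)

/-- **`#ker(Fr − s | E[2^M](ℚ̄)) ≤ 2^{M+1}`** for any arithmetic Frobenius `Fr` at a good odd prime
`ℓ` with Gross's condition `FrobEqFrobInfty W K (2^{M'}) ℓ`, `1 ≤ M ≤ M'`, `s = ±1`: transport of
`natCard_ker_conj_sub_smul_le` along `P ↦ g⁻¹ P`. Brick B of road-K JET at the prime `2`.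
[cite: GrossLMS1991, §3 (3.2)–(3.4)] [cite: Jetchev2008, §3.2 (2) (p. 815)] -/
theorem natCard_ker_frob_sub_smul_le_of_frobEqFrobInfty {K : Type} [Field K] [NumberField K]
    {ℓ M M' : ℕ} (hℓ : ℓ.Prime) (hℓ2 : ℓ ≠ 2) (hF : FrobEqFrobInfty W K (2 ^ M') ℓ) (hM : 1 ≤ M)
    (hMM' : M ≤ M') {v : HeightOneSpectrum (𝓞 ℚ)} (hℓv : (ℓ : 𝓞 ℚ) ∈ v.asIdeal)
    (hgood : W.HasGoodReductionAt v) {Fr : absoluteGaloisGroup ℚ} (hFr : IsArithFrobAtPlace ℚ v Fr)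
    {s : ℤ} (hs : s = 1 ∨ s = -1) :
    Nat.card (DistribSMul.toAddMonoidHom (geomTorsion W ((2 ^ M : ℕ) : ℤ)) Fr -
        s • AddMonoidHom.id _).ker ≤ 2 ^ (M + 1) := by
  obtain ⟨g, c₀, hc₀, hFrP⟩ := exists_conj_of_frobEqFrobInfty W hℓ hℓ2 hF hMM' hℓv hgood hFr
  refine le_trans (le_of_eq ?_) (natCard_ker_conj_sub_smul_le W hc₀ hM hs)
  refine Nat.card_congr ((MulAction.toPerm g⁻¹).subtypeEquiv fun P => ?_)
  change P ∈ (DistribSMul.toAddMonoidHom (geomTorsion W ((2 ^ M : ℕ) : ℤ)) Fr -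
      s • AddMonoidHom.id _).ker ↔
    g⁻¹ • P ∈ (DistribSMul.toAddMonoidHom (geomTorsion W ((2 ^ M : ℕ) : ℤ)) c₀ -
      s • AddMonoidHom.id _).ker
  rw [AddMonoidHom.mem_ker, AddMonoidHom.mem_ker, AddMonoidHom.sub_apply, AddMonoidHom.sub_apply,
    AddMonoidHom.smul_apply, AddMonoidHom.smul_apply, AddMonoidHom.id_apply, AddMonoidHom.id_apply]
  change Fr • P - s • P = 0 ↔ c₀ • (g⁻¹ • P) - s • (g⁻¹ • P) = 0
  rw [hFrP P, ← smul_eq_zero_iff_eq g (x := c₀ • (g⁻¹ • P) - s • (g⁻¹ • P)), smul_sub,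
    smul_comm g s, smul_smul g g⁻¹, mul_inv_cancel, one_smul]

/-- **An `s`-eigenvector of `Fr` of order `2^M` in `E[2^M](ℚ̄)`** under the same hypotheses:
transport of `exists_conj_eigen_pow_smul_ne_zero` along `P ↦ g P`.
[cite: GrossLMS1991, §3 (3.2)–(3.4)] [cite: Jetchev2008, §3.2 (2) (p. 815)] -/
theorem exists_frob_eigen_pow_smul_ne_zero {K : Type} [Field K] [NumberField K]
    {ℓ M M' : ℕ} (hℓ : ℓ.Prime) (hℓ2 : ℓ ≠ 2) (hF : FrobEqFrobInfty W K (2 ^ M') ℓ) (hM : 1 ≤ M)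
    (hMM' : M ≤ M') {v : HeightOneSpectrum (𝓞 ℚ)} (hℓv : (ℓ : 𝓞 ℚ) ∈ v.asIdeal)
    (hgood : W.HasGoodReductionAt v) {Fr : absoluteGaloisGroup ℚ} (hFr : IsArithFrobAtPlace ℚ v Fr)
    {s : ℤ} (hs : s = 1 ∨ s = -1) :
    ∃ P : geomTorsion W ((2 ^ M : ℕ) : ℤ), Fr • P = s • P ∧ (2 ^ (M - 1)) • P ≠ 0 := by
  obtain ⟨g, c₀, hc₀, hFrP⟩ := exists_conj_of_frobEqFrobInfty W hℓ hℓ2 hF hMM' hℓv hgood hFr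
  obtain ⟨P₀, hP₀, hP₀ne⟩ := exists_conj_eigen_pow_smul_ne_zero W hc₀ hM hs
  refine ⟨g • P₀, ?_, fun h0 => hP₀ne ?_⟩
  · rw [hFrP, smul_smul g⁻¹ g, inv_mul_cancel, one_smul, hP₀, smul_comm]
  · rw [smul_comm, smul_eq_zero_iff_eq] at h0
    exact h0

end Summit.BirchSwinnertonDyer.BirchSwinnertonDyer.Theorems.KolyvaginLowerBoundAtTwo

end
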